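/-
Copyright (c) 2026 the pub-hodgecm-mathlib formalisation cell (harness21).  Prover seat hodgecm-mathlib-R90-C10-p03 (g2), SLAB R90-TF, section S1 «Ch. 10∕12 local»;
crux H413 = `stmt-HodgeConjecture-24833`; (S-W) wild corner of U4Keys :182, card (c2) «FAMILY Z WITNESS WITH THE DEFECT» (line lead ∕ acting dealer R90-C10-p05 (g3), ruling
R-SW-4, 2026-09-05T04:00:33Z; finding `R90/R90-C10-p05/g3/WILD-COVER-GAP.v1.md` 9381e9d31740a03d): ★ `K2E3TwoDepthDepthWitness.exists_familyZ_witness_twoDepth` with the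
integral trace-one hypothesis `|t| ≤ 1` replaced by MINIMALITY + the DEFECT LETTER `|t|·|ϖ|^δ ≤ 1` and the regime letter `hε` shifted by `δ` — the wild places.
KERNEL module: THEOREMS ONLY (no definition, no named fact, no `sorry`, no instance, no notation).  2026-09-05.
-/
import Summits.HodgeConjecture.HodgeConjecture.Theorems.K2E3TwoDepthDepthWitness           -- ★ (K2E3-p34): `exists_familyZ_witness_twoDepth` (integral `t`), `conj_upper_apply_*`, the `Valuation` frame; brings ★ p862372 `familyZT_*`, ★ Z `le_of_mul_le_mul_v`, ★ D174 `test_twoDepth_iff`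
import Summits.HodgeConjecture.HodgeConjecture.Theorems.K2E3ConcaveLevelIwahoriCharacterMin  -- ★ (O1) p863752 (K2E3-p34 (g3)): `v_mul_norm_le_of_traceMin` (the Bruhat–Tits bound `|t·xσx| ≤ |z|` from minimality, [Tits1979 §1.15])
import HarnessLib

/-!
# R90-TF S1 «Ch10-local» ∕ K2 E3 «U4Keys» :182, (S-W) WILD corner — card (c2): FAMILY Z ON THE TWO-DEPTH GROUP WITH A MINIMAL TRACE-ONE ELEMENT AND THE DEFECT LETTER
# `u = u(0, b)`, `b = c·z⁻¹ − c·t·(z⁻¹ + (σz)⁻¹)`: `ū⁻¹uū ∈ J_e`, `(ū⁻¹uū)₀₀ = (1 + c)(1 + ε)`, `|ε| ≤ |ϖ|^{m+1}` — now for `|t| = |ϖ|^{−δ}` under `|ϖ|ᵏ·|x|² ≤ |ϖ|^{m+1+δ}·|z|`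
# [Roche1998 §3–§4; Tits1979 §1.15; Casselman1995 §6.3; Rogawski1990 §1.10]

Cell `pub/hodgecm-mathlib`, crux H413 = `stmt-HodgeConjecture-24833`, route of record `HCCMUnconditional` (no route verbs); R90-TF section S1 (base R90-C10), (S-W) line lead
∕ acting dealer R90-C10-p05 (g3) (rulings R-SW-1…5; this is deal (c2) of R-SW-4 — siblings (c1) family X with defect = R90-C10-p04 (g3), (c3) the wild cover = p05 (g3)), auditor
R90-C10-audit1 (g4).  THEOREMS ONLY; lane `--supports stmt-HodgeConjecture-24833 --as helper`, count-neutral.  NOT THE PAYER of :182 ∕ (S-W): (S-W)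
`sig_K2E3KeysThmTwoContractingRamifiedCharOnePosDepthWild` is the XL residual (REL over {HWA, HWRa, HWRb} by ★ (W-5)); this file is type-side INFRASTRUCTURE of the wild
determinant road — the Z-half of the `(J_e, θ)`-witness cover at a place where no INTEGRAL trace-one element exists.

THE POINT (p05 (g3)'s finding §Z, READ line by line against ★).  ★ `exists_familyZ_witness_twoDepth` uses `hvt : |t| ≤ 1` EXACTLY twice: (i) at ★ :301, to bound
`|c·t·xσx| ≤ |c|·|z|` through `|xσx| ≤ |z|` — but MINIMALITY of `t` gives the sharper `|t·xσx| ≤ |z|` for free (★ (O1) `v_mul_norm_le_of_traceMin`, the Bruhat–Tits bound from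
`z + σz + xσx = 0`: `−z∕(xσx)` has trace one); (ii) at ★ :311, to bound `|bz − c|·|z| = |c|·|t|·|x|²` by `|ϖ|ᵏ·|x|²` — with `|t| = |ϖ|^{−δ}` this costs `δ`, which the SHIFTED regime
letter `hε : |ϖ|ᵏ·|x|² ≤ |ϖ|^{m+1+δ}·|z|` and the DEFECT LETTER `hδ : |t|·|ϖ|^δ ≤ 1` repay: `|c||t||x|² ≤ |t|·|ϖ|ᵏ|x|² ≤ |t|·|ϖ|^{m+1+δ}|z| = (|t||ϖ|^δ)·|ϖ|^{m+1}|z| ≤ |ϖ|^{m+1}|z|`.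
Every other line of ★'s proof is `t`-free and is kept TOKEN FOR TOKEN (same `u`, same entries ★ `conj_upper_apply_*` ∕ `conj_upper_entries_of_y_eq_zero`, same six monomial bounds, same
membership test ★ D174 `test_twoDepth_iff`, same `ε = (bz − c)∕(1 + c)`).
* §1 **`exists_familyZ_witness_twoDepth_ofDefect`** — ★'s statement with `(hvt : Valued.v t ≤ 1)` ↦ `(htmin : ∀ a, a + σ a = 1 → Valued.v t ≤ Valued.v a)
  (hδ : Valued.v t * Valued.v ϖ ^ δ ≤ 1)` (`δ` joins the implicit `{k m δ : ℕ}`) and `hε` ↦ `(hε : Valued.v ϖ ^ k * (Valued.v x * Valued.v x) ≤ Valued.v ϖ ^ (m + 1 + δ) * Valued.v z)`; conclusion VERBATIM.  At `δ = 0` with an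
  integral `t` (minimal by ★ (O1) `traceMin_of_v_le_one`) it is ★'s statement again.
HONEST LABEL.  HC_CM is proved only modulo the 7 printed citations (2 remaining named inputs: hLiu418 = `stmt-HodgeConjecture-24832`, h413 = `stmt-HodgeConjecture-24833`) until
rung 0 closes; count-neutral — this file pays NO socket ((S-W) ∕ :182 ∕ A2′ ∕ C :88∕:98 OPEN); no printed citation is discharged; REL ≠ ★ ≠ BUILT.

## References
* [Roche1998] A. Roche, *Types and Hecke algebras for principal series representations of split reductive p-adic groups*, Ann. Sci. ÉNS (4) 31 (1998), §3–§4.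
* [Tits1979] J. Tits, *Reductive groups over local fields*, Proc. Sympos. Pure Math. 33.1 (1979), §1.15 (the ramified quasi-split `SU₃`: the maximal trace element and `U_{2a+k}`).
* [Casselman1995] W. Casselman, *Introduction to the theory of admissible representations of `p`-adic reductive groups* (1995), §6.3.
* [Rogawski1990] J. D. Rogawski, *Automorphic Representations of Unitary Groups in Three Variables*, Ann. of Math. Stud. 123 (1990), §1.9–§1.10 pp. 8–9.
* [Serre1979] J.-P. Serre, *Local Fields*, GTM 67 (1979), Ch. II §1.
-/

set_option autoImplicit false
-- the mandated namespace repeats the single-problem summit's segment (`HodgeConjecture.HodgeConjecture`)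
set_option linter.dupNamespace false

noncomputable section

open Matrix Literature.NumberTheory.Automorphic Literature.NumberTheory.Automorphic.UnitaryGroup
open scoped Matrix MatrixGroups WithZero Pointwise

namespace Summit.HodgeConjecture.HodgeConjecture.R90.S1.WildFamilyZWitness

open Summit.HodgeConjecture.HodgeConjecture.Cruxes.H413
open Summit.HodgeConjecture.HodgeConjecture.Cruxes.H413.K2E3LevelNDepthWitnessZ
open Summit.HodgeConjecture.HodgeConjecture.Cruxes.H413.K2E3LevelNDepthWitnessX
open Summit.HodgeConjecture.HodgeConjecture.Cruxes.H413.K2E3LevelNDepthWitnessTraceOne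
open Summit.HodgeConjecture.HodgeConjecture.Cruxes.H413.K2E3TwoDepthDepthWitness

section Valuation

variable {K : Type*} [Field K] [Valued K ℤᵐ⁰] [ValuativeRel K] [(Valued.v : Valuation K ℤᵐ⁰).Compatible]
  (σ : K →+* K) {ϖ : K} {J : Matrix (Fin 3) (Fin 3) K} (hJ : J = (StdForm.antidiagonal 3).over K)
  (hσ : ∀ a, σ (σ a) = a) (hvσ : ∀ a, Valued.v (σ a) = Valued.v a) (hvϖ : Valued.v ϖ = WithZero.exp (-1 : ℤ))
  (r s r' s' : ℕ) (Jg : Subgroup ↥(unitaryGroupOfForm σ J))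
  (hJg : ∀ k, k ∈ Jg ↔ ∀ i j, Valued.v (((k : GL (Fin 3) K) : Matrix (Fin 3) (Fin 3) K) i j) ≤
    Valued.v ϖ ^ (![![0, r, s], ![r', 0, r], ![s', r', 0]] : Fin 3 → Fin 3 → ℕ) i j)

/-! ## §1 Family Z on the two-depth group with a minimal trace-one element and the defect letter -/

include hJ hσ hvσ hvϖ hJg in
set_option maxHeartbeats 800000 in
-- one `u ∈ N`, seven entries, six valuation bounds (as ★ Z ∕ ★ `exists_familyZ_witness_twoDepth`)
/-- **FAMILY Z ON `J_e` WITH A MINIMAL TRACE-ONE ELEMENT AND THE DEFECT LETTER (wild places).**  `ū ∈ U(σ, Φ₃)` with matrix `ū(x, z)` (`z + σz + xσx = 0`, `|x|, |z| ≤ 1`); `c` with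
`σc = c`, `|c| ≤ |ϖ|ᵏ` (`1 ≤ k`); a trace-one `t` which is MINIMAL (`|t| ≤ |a|` for every trace-one `a`; `|t| > 1` allowed) with the DEFECT LETTER `|t|·|ϖ|^δ ≤ 1`; regime
`|ϖ|ᵏ ≤ |ϖ|ˢ·|z|`, `|ϖ|ᵏ·|x| ≤ |ϖ|ʳ·|z|`, `|ϖ|ᵏ·|x| ≤ |ϖ|^{r′}`, `|ϖ|ᵏ·|z| ≤ |ϖ|^{s′}`, and the δ-SHIFTED `|ϖ|ᵏ·|x|² ≤ |ϖ|^{m+1+δ}·|z|`.  Then `u := u(0, b)`,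
`b = c·z⁻¹ − c·t·(z⁻¹ + (σz)⁻¹)`, lies in `N`, `ū⁻¹ u ū ∈ J_e`, and `(ū⁻¹ u ū)₀₀ = (1 + c)(1 + ε)` with `|ε| ≤ |ϖ|^{m+1}` — ★ `exists_familyZ_witness_twoDepth`'s conclusion VERBATIM; its
proof with `|bz| ≤ |c|` from MINIMALITY (`|t·xσx| ≤ |z|`, ★ (O1) `v_mul_norm_le_of_traceMin`, [Tits1979 §1.15]) and `|bz − c| ≤ |ϖ|^{m+1}` from the shifted `hε` and `hδ`
(`|c||t||x|² ≤ |t|·|ϖ|^{m+1+δ}|z| ≤ |ϖ|^{m+1}|z|`). [cite: Roche1998, §3–§4] [cite: Tits1979, §1.15] [cite: Casselman1995, §6.3] [cite: Rogawski1990, §1.10 p. 9] -/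
theorem exists_familyZ_witness_twoDepth_ofDefect {k m δ : ℕ} (hk : 1 ≤ k) {nb : ↥(unitaryGroupOfForm σ J)} {x z c t : K}
    (hnb : ((nb : GL (Fin 3) K) : Matrix (Fin 3) (Fin 3) K) = !![1, 0, 0; -σ x, 1, 0; z, x, 1]) (hrel : z + σ z + x * σ x = 0)
    (hx1 : Valued.v x ≤ 1) (hz1 : Valued.v z ≤ 1)
    (hzs : Valued.v ϖ ^ k ≤ Valued.v ϖ ^ s * Valued.v z) (hxzr : Valued.v ϖ ^ k * Valued.v x ≤ Valued.v ϖ ^ r * Valued.v z)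
    (hxr' : Valued.v ϖ ^ k * Valued.v x ≤ Valued.v ϖ ^ r') (hzs' : Valued.v ϖ ^ k * Valued.v z ≤ Valued.v ϖ ^ s')
    (hε : Valued.v ϖ ^ k * (Valued.v x * Valued.v x) ≤ Valued.v ϖ ^ (m + 1 + δ) * Valued.v z)
    (hσc : σ c = c) (hc : Valued.v c ≤ Valued.v ϖ ^ k) (ht : t + σ t = 1)
    (htmin : ∀ a : K, a + σ a = 1 → Valued.v t ≤ Valued.v a) (hδ : Valued.v t * Valued.v ϖ ^ δ ≤ 1) :
    ∃ u : ↥(unitaryGroupOfForm σ J), u ∈ unipotentU σ J ∧ nb⁻¹ * u * nb ∈ Jg ∧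
      ∃ ε : K, Valued.v ε ≤ Valued.v ϖ ^ (m + 1) ∧
        (((nb⁻¹ * u * nb : ↥(unitaryGroupOfForm σ J)) : GL (Fin 3) K) : Matrix (Fin 3) (Fin 3) K) 0 0 = (1 + c) * (1 + ε) := by
  have hϖ0 : ϖ ≠ 0 := CartanUnique.uniformizer_ne_zero hvϖ
  have hvϖ0 : Valued.v ϖ ≠ 0 := (Valuation.ne_zero_iff _).2 hϖ0
  have hvϖ1 : Valued.v ϖ ≤ 1 := by rw [hvϖ, ← WithZero.exp_zero, WithZero.exp_le_exp]; norm_num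
  have hvϖlt : Valued.v ϖ < 1 := by rw [hvϖ, ← WithZero.exp_zero, WithZero.exp_lt_exp]; norm_num
  have hvϖklt : Valued.v ϖ ^ k < 1 := pow_lt_one' hvϖlt (Nat.one_le_iff_ne_zero.1 hk)
  have hz : z ≠ 0 := fun h => by
    rw [h, map_zero, mul_zero] at hzs
    exact absurd hzs (not_le.2 (pow_pos (zero_lt_iff.2 hvϖ0) k))
  have hvz0 : Valued.v z ≠ 0 := (Valuation.ne_zero_iff _).2 hz
  have hσz : σ z ≠ 0 := (map_ne_zero σ).2 hz
  -- MINIMALITY ([Tits1979 §1.15]): `|t·xσx| ≤ |z|` from the relation (★ (O1) §1) — replaces ★'s `|t| ≤ 1`, `|xσx| ≤ |z|`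
  have htxx : Valued.v (t * (x * σ x)) ≤ Valued.v z := K2E3ConcaveLevelIwahoriCharacterMin.v_mul_norm_le_of_traceMin σ hσ htmin hrel
  -- the element `u = u(0, b)`
  obtain ⟨b, hb⟩ : ∃ b : K, b = c * z⁻¹ - c * t * (z⁻¹ + (σ z)⁻¹) := ⟨_, rfl⟩
  obtain ⟨u, huN, hu⟩ := K2E3LowerUnipotentBigCellIntegral.exists_upper_of_rel σ hJ hσ (a := 0) (b := b) (familyZT_rel σ hσ hσc ht hb)
  -- `|bz| ≤ |c| ≤ |ϖ|ᵏ`: `|bz|·|z| = |c·σz + c·t·xσx| ≤ |c|·|z|`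
  have hvbz : Valued.v (b * z) ≤ Valued.v ϖ ^ k := by
    have key := congrArg Valued.v (familyZT_mul_eq σ hrel hz hσz hb)
    rw [map_mul Valued.v (b * z) (σ z), hvσ] at key
    have hR : Valued.v (c * σ z + c * t * (x * σ x)) ≤ Valued.v c * Valued.v z := by
      refine Valued.v.map_add_le ?_ ?_
      · rw [map_mul, hvσ]
      · rw [mul_assoc, map_mul]
        exact mul_le_mul' le_rfl htxx
    rw [← key] at hR
    exact (le_of_mul_le_mul_v hR hvz0).trans hc
  -- `|bz − c| ≤ |ϖ|^{m+1}`: `|bz − c|·|z| = |c|·|t|·|x|² ≤ |t|·|ϖ|ᵏ|x|² ≤ |t|·|ϖ|^{m+1+δ}|z| = (|t||ϖ|^δ)·|ϖ|^{m+1}|z| ≤ |ϖ|^{m+1}|z|` (the DEFECT)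
  have hvsub : Valued.v (b * z - c) ≤ Valued.v ϖ ^ (m + 1) := by
    have key := congrArg Valued.v (familyZT_sub_mul_eq σ hrel hz hσz hb)
    rw [map_mul Valued.v (b * z - c) (σ z), hvσ, map_mul Valued.v (c * t) (x * σ x), map_mul Valued.v c t, map_mul Valued.v x (σ x), hvσ] at key
    have h : Valued.v (b * z - c) * Valued.v z ≤ Valued.v ϖ ^ (m + 1) * Valued.v z := by
      rw [key]
      calc Valued.v c * Valued.v t * (Valued.v x * Valued.v x) ≤ Valued.v ϖ ^ k * Valued.v t * (Valued.v x * Valued.v x) :=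
            mul_le_mul' (mul_le_mul' hc le_rfl) le_rfl
        _ = Valued.v t * (Valued.v ϖ ^ k * (Valued.v x * Valued.v x)) := by ac_rfl
        _ ≤ Valued.v t * (Valued.v ϖ ^ (m + 1 + δ) * Valued.v z) := mul_le_mul' le_rfl hε
        _ = (Valued.v t * Valued.v ϖ ^ δ) * (Valued.v ϖ ^ (m + 1) * Valued.v z) := by rw [pow_add]; ac_rfl
        _ ≤ 1 * (Valued.v ϖ ^ (m + 1) * Valued.v z) := mul_le_mul' hδ le_rfl
        _ = Valued.v ϖ ^ (m + 1) * Valued.v z := one_mul _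
    exact le_of_mul_le_mul_v h hvz0
  -- `|b| ≤ |ϖ|ˢ ≤ 1`: `|b|·|z| ≤ |ϖ|ᵏ ≤ |ϖ|ˢ|z|`
  have hvbs : Valued.v b ≤ Valued.v ϖ ^ s := by
    refine le_of_mul_le_mul_v (C := Valued.v z) ?_ hvz0
    rw [← map_mul]; exact hvbz.trans hzs
  have hvb : Valued.v b ≤ 1 := hvbs.trans (pow_le_one' hvϖ1 s)
  -- `u`, `ū`, hence `j = ū⁻¹ u ū`, are integral
  have huK : (u : GL (Fin 3) K) ∈ glInt 3 K := mem_glInt_of_coe_eq σ hJ hvσ hu fun i j => by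
    fin_cases i <;> fin_cases j <;> simp [hvb]
  have hnbK : (nb : GL (Fin 3) K) ∈ glInt 3 K := mem_glInt_of_coe_eq_lower σ hJ hvσ hnb hx1 hz1
  have hjK : nb⁻¹ * u * nb ∈ (glInt 3 K).subgroupOf (unitaryGroupOfForm σ J) :=
    Subgroup.mul_mem _ (Subgroup.mul_mem _ (Subgroup.inv_mem _ (Subgroup.mem_subgroupOf.2 hnbK)) (Subgroup.mem_subgroupOf.2 huK))
      (Subgroup.mem_subgroupOf.2 hnbK)
  -- the entries (`y = 0`)
  obtain ⟨e00, e10, e20, e21⟩ := K2E3LowerUnipotentConjUpperEntries.conj_upper_entries_of_y_eq_zero σ hJ hσ hnb hu hrel rfl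
  have e01 := conj_upper_apply_zero_one σ hJ hσ hnb hu
  have e02 := conj_upper_apply_zero_two σ hJ hσ hnb hu
  have e12 := conj_upper_apply_one_two σ hJ hσ hnb hu
  -- the monomials
  have hbx : Valued.v (b * x) ≤ Valued.v ϖ ^ r := by
    -- `|b||x|·|z| = |bz|·|x| ≤ |ϖ|ᵏ|x| ≤ |ϖ|ʳ|z|`
    refine le_of_mul_le_mul_v (C := Valued.v z) ?_ hvz0
    calc Valued.v (b * x) * Valued.v z = Valued.v (b * z) * Valued.v x := by rw [map_mul, map_mul]; exact mul_right_comm _ _ _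
      _ ≤ Valued.v ϖ ^ k * Valued.v x := mul_le_mul' hvbz le_rfl
      _ ≤ Valued.v ϖ ^ r * Valued.v z := hxzr
  have hxb : Valued.v (σ x * b) ≤ Valued.v ϖ ^ r := by rw [map_mul, hvσ, mul_comm, ← map_mul]; exact hbx
  have hxbz : Valued.v (σ x * b * z) ≤ Valued.v ϖ ^ r' := by
    rw [mul_assoc, map_mul, hvσ, mul_comm]
    exact (mul_le_mul' hvbz le_rfl).trans hxr'
  have hzbx : Valued.v (σ z * b * x) ≤ Valued.v ϖ ^ r' := by
    rw [show σ z * b * x = (b * σ z) * x by ring, map_mul, map_mul, hvσ, ← map_mul]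
    exact (mul_le_mul' hvbz le_rfl).trans hxr'
  have hzbz : Valued.v (σ z * b * z) ≤ Valued.v ϖ ^ s' := by
    rw [show σ z * b * z = (b * z) * σ z by ring, map_mul, hvσ]
    exact (mul_le_mul' hvbz le_rfl).trans hzs'
  refine ⟨u, huN, ?_, ?_⟩
  · rw [hJg, K2E3IwahoriTwoDepthFactorisation.test_twoDepth_iff σ hvϖ1 r s r' s']
    refine ⟨(mem_glInt_subgroupOf_iff σ hJ hvσ _).1 hjK, ?_, ?_, ?_, ?_, ?_, ?_⟩
    · rw [e01, zero_add]; exact hbx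
    · rw [e12, map_zero, sub_zero]; exact hxb
    · rw [e02]; exact hvbs
    · rw [e10]; exact hxbz
    · rw [e21]; exact hzbx
    · rw [e20]; exact hzbz
  · have hclt : Valued.v c < Valued.v (1 : K) := by rw [Valuation.map_one]; exact lt_of_le_of_lt hc hvϖklt
    have h1c : Valued.v (1 + c) = 1 := by rw [Valuation.map_add_eq_of_lt_left _ hclt, Valuation.map_one]
    have h1c0 : (1 + c : K) ≠ 0 := fun h => by rw [h, map_zero] at h1c; exact zero_ne_one h1c
    refine ⟨(b * z - c) / (1 + c), ?_, ?_⟩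
    · rw [map_div₀, h1c, div_one]; exact hvsub
    · rw [e00]
      field_simp
      ring

end Valuation

end Summit.HodgeConjecture.HodgeConjecture.R90.S1.WildFamilyZWitness

end
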